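import Summits.Ventures.YMGap.Thresholds.StarLimitStates
import Literature.Barriers.QuantumFields.NonabelianCoulombPhaseD5
import HarnessLib

/-!
# Venture YMGap — track (c) «DS»: exponential decay of the plaquette–plaquette correlation function in
# every infinite-volume limit state of `SU(2)` lattice Yang–Mills (`d = 4`), given the star window bound

HONEST FRAMING: venture file (cell `pub-ymgap`, PLAN R99/R101–R103/R108), strong-coupling LATTICE statement
only.  INPUT: the hypothesis schema `StarWindowBound L β_W ρ r` (`StarWindow.lean`) on all large tori with
`ρ < 1` — or, in the Lemma-G form, the binder of `DSWindow.su2_strongCouplingFront_of_lemmaG` (discharged by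
ds-4's `starWindowBound_lemmaG` for `β_W ≤ 1/2`; not this file).  OUTPUT, kernel-checked GIVEN that input:
for every infinite-volume limit state `μ ∈ infiniteVolumeLimitPoints (d := 4) (fundamentalRep (Fin 2)) (β_W/2)`
the plaquette–plaquette correlation function `plaquetteCorrFn (fundamentalRep (Fin 2)) μ` (Chatterjee's
`f_β`; the operational mass-gap criterion of Montvay–Münster §3.4.5) decays exponentially — the translation
of `StarLimit.su2Star_isMassiveState` (tree) through the tree's plaquette criterion
`Literature.Barriers.QuantumFields.not_exists_clusteringRate_of_not_hasExponentialDecay_plaquetteCorrFn`.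
Nothing about uniqueness of the DLR state, the continuum, confinement or a transfer-matrix gap.  The
hypothesis-free rows at `β_W ≤ 9/25` are one-liners on top of this file once `StarWindowBoundLemmaG` lands
(cell file `HOME/ds/engine/limit/StarLimitMassive.lean`).
-/

noncomputable section

open MeasureTheory
open Literature.Probability.LatticeModels
open Literature.MathematicalPhysics.QuantumLattice (fundamentalRep infiniteVolumeLimitPoints plaquetteCorrFn
  continuous_fundamentalRep fundamentalRep_mem_unitaryGroup)
open Literature.MathematicalPhysics.QuantumFieldTheory
open Literature.Barriers.QuantumFields (IsMassiveState)
open Summit.Ventures.YMGap.DSWindow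
open Summit.Ventures.YMGap.StarWindowGauge (gaugeR)

namespace Summit.Ventures.YMGap.StarLimit

/-- A massive infinite-volume limit state of `SU(2)` lattice Yang–Mills (`d = 4`) has an exponentially
decaying plaquette–plaquette correlation function (contrapositive of the tree's plaquette criterion
`not_exists_clusteringRate_of_not_hasExponentialDecay_plaquetteCorrFn`, whose conclusion is literally
`¬ IsMassiveState μ`). -/
theorem hasExponentialDecay_plaquetteCorrFn_of_isMassiveState {β : ℝ}
    {μ : Measure (Literature.MathematicalPhysics.QuantumLattice.LGConfig 4
      (Matrix.specialUnitaryGroup (Fin 2) ℂ))}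
    (hμ : μ ∈ infiniteVolumeLimitPoints (d := 4) (fundamentalRep (Fin 2)) β) (hm : IsMassiveState μ) :
    HasExponentialDecay (plaquetteCorrFn (fundamentalRep (Fin 2)) μ) := by
  haveI : SecondCountableTopology (Matrix (Fin 2) (Fin 2) ℂ) :=
    inferInstanceAs (SecondCountableTopology (Fin 2 → Fin 2 → ℂ))
  haveI : SecondCountableTopology (Matrix.specialUnitaryGroup (Fin 2) ℂ) :=
    Topology.IsEmbedding.subtypeVal.secondCountableTopology
  obtain ⟨Lseq, hLmono, hμL⟩ := hμ
  haveI := hμL.1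
  by_contra h
  exact Literature.Barriers.QuantumFields.not_exists_clusteringRate_of_not_hasExponentialDecay_plaquetteCorrFn
    (fundamentalRep (Fin 2)) (continuous_fundamentalRep (Fin 2))
    (fun U => fundamentalRep_mem_unitaryGroup U) h hm

/-- **Mass gap in the operational sense (Montvay–Münster §3.4.5; Chatterjee's `f_β`) for every
infinite-volume limit state, from the star window bound**: if every torus of side `L ≥ L₁` carries
`StarWindowBound L β_W ρ suFrobDist` with `ρ < 1`, then the plaquette–plaquette correlation function of
every limit state `μ ∈ infiniteVolumeLimitPoints (d := 4) (fundamentalRep (Fin 2)) (β_W/2)` decays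
exponentially. -/
theorem su2Star_hasExponentialDecay_plaquetteCorrFn (βW : ℝ) {ρ : ℝ} (hρ0 : 0 ≤ ρ) (hρ1 : ρ < 1)
    (L₁ : ℕ) (hS : ∀ (L : ℕ) [NeZero L], L₁ ≤ L → StarWindowBound L βW ρ suFrobDist) :
    ∀ μ ∈ infiniteVolumeLimitPoints (d := 4) (fundamentalRep (Fin 2)) (βW / 2),
      HasExponentialDecay (plaquetteCorrFn (fundamentalRep (Fin 2)) μ) :=
  fun μ hμ => hasExponentialDecay_plaquetteCorrFn_of_isMassiveState hμ
    (su2Star_isMassiveState βW hρ0 hρ1 L₁ hS μ hμ)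

/-- **Lemma-G form** (hypothesis = the binder of `DSWindow.su2_strongCouplingFront_of_lemmaG`, discharged
by `starWindowBound_lemmaG` for `β_W ≤ 1/2`): at every `0 ≤ β_W ≤ β₀` with `β₀ ≤ 7/10`, `R_G(β₀) < 1`,
the plaquette–plaquette correlation function of every infinite-volume limit state decays exponentially. -/
theorem su2_hasExponentialDecay_plaquetteCorrFn_of_lemmaG (β₀ : ℝ) (h0 : 0 ≤ β₀) (h7 : β₀ ≤ 7 / 10)
    (hρ : gaugeR β₀ < 1)
    (hG : ∀ (L : ℕ) [NeZero L], 3 ≤ L → ∀ βW : ℝ, 0 ≤ βW → βW ≤ β₀ →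
      StarWindowBound L βW (gaugeR βW) suFrobDist)
    {βW : ℝ} (hβ0 : 0 ≤ βW) (hβ1 : βW ≤ β₀) :
    ∀ μ ∈ infiniteVolumeLimitPoints (d := 4) (fundamentalRep (Fin 2)) (βW / 2),
      HasExponentialDecay (plaquetteCorrFn (fundamentalRep (Fin 2)) μ) :=
  fun μ hμ => hasExponentialDecay_plaquetteCorrFn_of_isMassiveState hμ
    (su2_isMassiveState_of_lemmaG β₀ h0 h7 hρ hG hβ0 hβ1 μ hμ)

/-- **The `9/25` row**: given Lemma G on all tori of side `≥ 3` up to `β_W = 9/25`, the plaquette–plaquette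
correlation function of every infinite-volume limit state of `SU(2)` lattice Yang–Mills (`d = 4`, Wilson)
decays exponentially at every `0 ≤ β_W ≤ 9/25`. -/
theorem su2_hasExponentialDecay_plaquetteCorrFn_le_9_25_of_lemmaG
    (hG : ∀ (L : ℕ) [NeZero L], 3 ≤ L → ∀ βW : ℝ, 0 ≤ βW → βW ≤ 9 / 25 →
      StarWindowBound L βW (gaugeR βW) suFrobDist)
    {βW : ℝ} (hβ0 : 0 ≤ βW) (hβ1 : βW ≤ 9 / 25) :
    ∀ μ ∈ infiniteVolumeLimitPoints (d := 4) (fundamentalRep (Fin 2)) (βW / 2),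
      HasExponentialDecay (plaquetteCorrFn (fundamentalRep (Fin 2)) μ) :=
  fun μ hμ => hasExponentialDecay_plaquetteCorrFn_of_isMassiveState hμ
    (su2_isMassiveState_le_9_25_of_lemmaG hG hβ0 hβ1 μ hμ)

end Summit.Ventures.YMGap.StarLimit

end
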